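import Mathlib
import Summits.RiemannHypothesis.RiemannHypothesis.Theorems.SoloBlindLatticeBlind

/-!
# SoloBlind artefact 12 — one deep pair in the critical lattice (Theorem D7(ii))

Context (soloist `solo-RiemannHypothesis-blind`, claims C43/C45, report `paper/window-height.md` §10.3).
Notation as in artefact 7 (`SoloBlindLatticeBlind`): for a test function `g` supported in an interval of
length `T = 2π/s` put `H_g(z) = ∫ g(x) e^{izx} dx` (written out as an integral in every statement).  A zero ON the critical line
with ordinate `u` contributes `|H_g(u)|²` to the zero side of Weil's explicit formula for `g ⋆ g̃`, a
conjugate pair OFF the line by `δ` at ordinate `u` contributes `2 · Re [H_g(u - iδ) · conj H_g(u + iδ)]`.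

**Configuration `Z₁(δ)`** ("one deep pair in the critical lattice"): the on-line lattice `u_j = u₀ + j s`
(`j ∈ ℤ`) with the site `j = 0` REPLACED by the conjugate pair `u₀ ∓ iδ`.  Its zero-side functional is
`Q(g) = Σ_{j ≠ 0} |H_g(u_j)|² + 2 Re [H_g(u₀ - iδ) conj H_g(u₀ + iδ)]`.

* `soloBlind_deepPair_hasSum` (general `g ∈ L²` supported in an interval of length `2π/s`):
  `Q(g) = (2π/s) ‖g‖₂² - |H_g(u₀)|² + 2 Re [H_g(u₀ - iδ) conj H_g(u₀ + iδ)]`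
  (from Theorem D1 at `δ = 0`, artefact 7: the full on-line lattice sum is `(2π/s)‖g‖₂²`).
* `soloBlind_twoBump_exp_integral`: for real `φ` and the odd two-bump function `g₀ = φ(· - c₀) - φ(· + c₀)`,
  `∫ g₀(x) e^{εx} dx = 2 sinh(ε c₀) · ∫ φ(y) e^{εy} dy` for every real `ε`.
* `soloBlind_deepPair_twoBump` (the closed form of §10.3): for `φ` real, EVEN, integrable, compactly
  supported, with `g₀ ∈ L²` supported in the window, and `u₀ = 0`:
  `Q(g₀) = (2π/s) ‖g₀‖₂² - 8 m² sinh²(δ c₀)`,  `m = ∫ φ(y) e^{δy} dy`.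
* `soloBlind_deepPair_visible`: if moreover `φ ≥ 0` then `m ≥ ∫ φ`, so `Q(g₀) < 0` as soon as
  `8 (∫φ)² sinh²(δ c₀) > (2π/s) ‖g₀‖₂²` — a single pair of depth `δ` replacing one site of an on-line
  lattice of period `T = 2π/s ≥` (window length) is DETECTED by an explicit two-bump test function once
  `sinh²(δ c₀)` beats `T‖g₀‖²/(8(∫φ)²)`; with `φ` the indicator of `[-w/2, w/2]`, `c₀ = a - w/2`, `T = 2a(1+η)`
  (`w ≤ a`, lobes disjoint, `‖g₀‖₂² = 2w`, `∫φ = w`) this is `4 w sinh²(δ(a - w/2)) > T`; at `η = 0.2` the best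
  choice `w ≈ 0.57a` detects every depth `δ ≥ 1.26/a` (report §10.3; the subspace-optimal threshold over all
  test functions in the window is `1.17/a`, and pairs of depth `≤ 0.378/a` are invisible for EVERY `g`).

Mathlib + artefact 7 only; no sorries.
-/

open MeasureTheory Complex Set
open scoped Real ComplexConjugate

namespace Summit.RiemannHypothesis.RiemannHypothesis.Theorems


/-- **One deep pair in the critical lattice, general test function.**  For `g ∈ L²` supported in an
interval of length `2π/s`, the zero-side functional of `Z₁(δ)` (site `u₀` of the lattice `u₀ + sℤ`
replaced by the pair `u₀ ∓ iδ`) equals `(2π/s)‖g‖₂² - |H_g(u₀)|² + 2 Re[H_g(u₀ - iδ) conj H_g(u₀ + iδ)]`. -/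
theorem soloBlind_deepPair_hasSum (c s u₀ δ : ℝ) (hs : 0 < s) {g : ℝ → ℂ}
    (hg : MemLp g 2 volume) (hsupp : Function.support g ⊆ Ioc c (c + 2 * π / s)) :
    HasSum (fun j : ℤ => if j = 0 then
        2 * ((∫ x : ℝ, g x * cexp (I * ((u₀ : ℂ) - I * δ) * (x : ℂ))) *
            conj ((∫ x : ℝ, g x * cexp (I * ((u₀ : ℂ) + I * δ) * (x : ℂ))))).re
      else ‖(∫ x : ℝ, g x * cexp (I * (((u₀ + j * s : ℝ) : ℂ)) * (x : ℂ)))‖ ^ 2)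
      ((2 * π / s) * (∫ x : ℝ, ‖g x‖ ^ 2) - ‖(∫ x : ℝ, g x * cexp (I * ((u₀ : ℂ)) * (x : ℂ)))‖ ^ 2
        + 2 * ((∫ x : ℝ, g x * cexp (I * ((u₀ : ℂ) - I * δ) * (x : ℂ))) *
            conj ((∫ x : ℝ, g x * cexp (I * ((u₀ : ℂ) + I * δ) * (x : ℂ))))).re) := by
  classical
  have h0 := soloBlind_lattice_blindness c s u₀ 0 hs hg hsupp
  have hterm : ∀ j : ℤ, (∫ x : ℝ, g x * cexp (I * (((u₀ + j * s : ℝ) : ℂ) - I * (0 : ℝ)) * x)) *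
        conj (∫ x : ℝ, g x * cexp (I * (((u₀ + j * s : ℝ) : ℂ) + I * (0 : ℝ)) * x))
      = ((‖(∫ x : ℝ, g x * cexp (I * (((u₀ + j * s : ℝ) : ℂ)) * (x : ℂ)))‖ ^ 2 : ℝ) : ℂ) := by
    intro j
    have e1 : (((u₀ + j * s : ℝ) : ℂ) - I * (0 : ℝ)) = ((u₀ + j * s : ℝ) : ℂ) := by simp
    have e2 : (((u₀ + j * s : ℝ) : ℂ) + I * (0 : ℝ)) = ((u₀ + j * s : ℝ) : ℂ) := by simp
    rw [e1, e2, Complex.mul_conj, Complex.normSq_eq_norm_sq]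
  simp_rw [hterm] at h0
  have h1 : HasSum (fun j : ℤ => ‖(∫ x : ℝ, g x * cexp (I * (((u₀ + j * s : ℝ) : ℂ)) * (x : ℂ)))‖ ^ 2)
      ((2 * π / s) * ∫ x : ℝ, ‖g x‖ ^ 2) := Complex.hasSum_ofReal.mp h0
  set P : ℝ := 2 * ((∫ x : ℝ, g x * cexp (I * ((u₀ : ℂ) - I * δ) * (x : ℂ))) *
      conj ((∫ x : ℝ, g x * cexp (I * ((u₀ : ℂ) + I * δ) * (x : ℂ))))).re
    with hP
  have h2 := h1.update 0 P
  have hfun : Function.update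
        (fun j : ℤ => ‖(∫ x : ℝ, g x * cexp (I * (((u₀ + j * s : ℝ) : ℂ)) * (x : ℂ)))‖ ^ 2) 0 P =
      fun j : ℤ => if j = 0 then P
        else ‖(∫ x : ℝ, g x * cexp (I * (((u₀ + j * s : ℝ) : ℂ)) * (x : ℂ)))‖ ^ 2 := by
    funext j
    rw [Function.update_apply]
  rw [hfun] at h2
  have hval : P - ‖(∫ x : ℝ, g x * cexp (I * (((u₀ + (0 : ℤ) * s : ℝ) : ℂ)) * (x : ℂ)))‖ ^ 2
        + (2 * π / s) * ∫ x : ℝ, ‖g x‖ ^ 2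
      = (2 * π / s) * (∫ x : ℝ, ‖g x‖ ^ 2)
        - ‖(∫ x : ℝ, g x * cexp (I * ((u₀ : ℂ)) * (x : ℂ)))‖ ^ 2 + P := by
    simp only [Int.cast_zero, zero_mul, add_zero]
    ring
  rw [hval] at h2
  exact h2

/-- Integrability of `φ · e^{ε y}` for an integrable `φ` supported in `[-b, b]`. -/
theorem soloBlind_integrable_mul_exp {φ : ℝ → ℝ} {b : ℝ} (hφ : Integrable φ)
    (hsupp : Function.support φ ⊆ Icc (-b) b) (ε : ℝ) :
    Integrable (fun y => φ y * Real.exp (ε * y)) := by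
  have hbound : ∀ y, ‖φ y * Real.exp (ε * y)‖ ≤ Real.exp (|ε| * |b|) * ‖φ y‖ := by
    intro y
    by_cases hy : φ y = 0
    · simp [hy]
    · have hyI : y ∈ Icc (-b) b := hsupp hy
      rw [norm_mul, Real.norm_eq_abs, Real.norm_eq_abs, abs_of_pos (Real.exp_pos _), mul_comm]
      apply mul_le_mul_of_nonneg_right _ (abs_nonneg _)
      rw [Real.exp_le_exp]
      calc ε * y ≤ |ε * y| := le_abs_self _
        _ = |ε| * |y| := abs_mul _ _
        _ ≤ |ε| * |b| := mul_le_mul_of_nonneg_left (abs_le_abs hyI.2 (by linarith [hyI.1])) (abs_nonneg _)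
  have hmeas : AEStronglyMeasurable (fun y => φ y * Real.exp (ε * y)) volume := by
    have hc : Continuous fun y : ℝ => Real.exp (ε * y) := by fun_prop
    exact hφ.aestronglyMeasurable.mul hc.aestronglyMeasurable
  exact (hφ.norm.const_mul (Real.exp (|ε| * |b|))).mono' hmeas (Filter.Eventually.of_forall hbound)

/-- `∫ φ(x - c₀) e^{εx} dx = e^{ε c₀} ∫ φ(y) e^{εy} dy` (translation invariance). -/
theorem soloBlind_integral_shift_sub_exp (φ : ℝ → ℝ) (c₀ ε : ℝ) :
    ∫ x, φ (x - c₀) * Real.exp (ε * x) = Real.exp (ε * c₀) * ∫ y, φ y * Real.exp (ε * y) := by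
  have h := integral_sub_right_eq_self (μ := volume) (fun y => φ y * Real.exp (ε * (y + c₀))) c₀
  simp only [sub_add_cancel] at h
  rw [h, ← integral_const_mul]
  congr 1
  funext y
  rw [mul_add, Real.exp_add]
  ring

/-- `∫ φ(x + c₀) e^{εx} dx = e^{-ε c₀} ∫ φ(y) e^{εy} dy` (translation invariance). -/
theorem soloBlind_integral_shift_add_exp (φ : ℝ → ℝ) (c₀ ε : ℝ) :
    ∫ x, φ (x + c₀) * Real.exp (ε * x) = Real.exp (-(ε * c₀)) * ∫ y, φ y * Real.exp (ε * y) := by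
  have h := integral_add_right_eq_self (μ := volume) (fun y => φ y * Real.exp (ε * (y - c₀))) c₀
  simp only [add_sub_cancel_right] at h
  rw [h, ← integral_const_mul]
  congr 1
  funext y
  rw [mul_sub, Real.exp_sub, Real.exp_neg]
  field_simp

/-- **Two-bump transform at imaginary points.**  For the odd two-bump function
`g₀ = φ(· - c₀) - φ(· + c₀)`:  `∫ g₀(x) e^{εx} dx = 2 sinh(ε c₀) ∫ φ(y) e^{εy} dy`. -/
theorem soloBlind_twoBump_exp_integral {φ : ℝ → ℝ} {b : ℝ} (hφ : Integrable φ)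
    (hsupp : Function.support φ ⊆ Icc (-b) b) (c₀ ε : ℝ) :
    ∫ x, (φ (x - c₀) - φ (x + c₀)) * Real.exp (ε * x)
      = 2 * Real.sinh (ε * c₀) * ∫ y, φ y * Real.exp (ε * y) := by
  have hI := soloBlind_integrable_mul_exp hφ hsupp ε
  have i1 : Integrable (fun x => φ (x - c₀) * Real.exp (ε * x)) := by
    have hfun : (fun x => φ (x - c₀) * Real.exp (ε * x)) =
        fun x => Real.exp (ε * c₀) * (φ (x - c₀) * Real.exp (ε * (x - c₀))) := by
      funext x
      rw [show ε * x = ε * c₀ + ε * (x - c₀) by ring, Real.exp_add]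
      ring
    rw [hfun]
    exact (hI.comp_sub_right c₀).const_mul _
  have i2 : Integrable (fun x => φ (x + c₀) * Real.exp (ε * x)) := by
    have hfun : (fun x => φ (x + c₀) * Real.exp (ε * x)) =
        fun x => Real.exp (-(ε * c₀)) * (φ (x + c₀) * Real.exp (ε * (x + c₀))) := by
      funext x
      rw [show ε * x = -(ε * c₀) + ε * (x + c₀) by ring, Real.exp_add]
      ring
    rw [hfun]
    exact (hI.comp_add_right c₀).const_mul _
  have hsplit : (fun x => (φ (x - c₀) - φ (x + c₀)) * Real.exp (ε * x)) =
      fun x => φ (x - c₀) * Real.exp (ε * x) - φ (x + c₀) * Real.exp (ε * x) := by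
    funext x; ring
  rw [hsplit, integral_sub i1 i2, soloBlind_integral_shift_sub_exp, soloBlind_integral_shift_add_exp,
    Real.sinh_eq]
  ring

/-- Evenness: `∫ φ(y) e^{-εy} dy = ∫ φ(y) e^{εy} dy` for even `φ`. -/
theorem soloBlind_even_exp_integral {φ : ℝ → ℝ} (heven : ∀ y, φ (-y) = φ y) (ε : ℝ) :
    ∫ y, φ y * Real.exp (-ε * y) = ∫ y, φ y * Real.exp (ε * y) := by
  have h := integral_neg_eq_self (fun y => φ y * Real.exp (ε * y)) volume
  rw [← h]
  congr 1
  funext y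
  rw [heven y, neg_mul, mul_neg]

/-- **THEOREM D7(ii), closed form (report §10.3).**  Let `φ` be real, even, integrable, supported in
`[-b, b]`, and let `g₀ = φ(· - c₀) - φ(· + c₀)` (as a complex-valued function) be square-integrable and
supported in an interval `(c, c + 2π/s]`.  For the configuration `Z₁(δ)` with `u₀ = 0` (on-line lattice
`sℤ`, the site `0` replaced by the pair `∓ iδ`):
`Q(g₀) = (2π/s)‖g₀‖₂² - 8 m² sinh²(δ c₀)`, `m = ∫ φ(y) e^{δy} dy`. -/
theorem soloBlind_deepPair_twoBump (c s δ c₀ b : ℝ) (hs : 0 < s) {φ : ℝ → ℝ}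
    (hφ : Integrable φ) (hφsupp : Function.support φ ⊆ Icc (-b) b) (heven : ∀ y, φ (-y) = φ y)
    {g₀ : ℝ → ℂ} (hg₀ : g₀ = fun x : ℝ => ((φ (x - c₀) - φ (x + c₀) : ℝ) : ℂ))
    (hg : MemLp g₀ 2 volume) (hsupp : Function.support g₀ ⊆ Ioc c (c + 2 * π / s)) :
    HasSum (fun j : ℤ => if j = 0 then
        2 * ((∫ x : ℝ, g₀ x * cexp (I * (((0 : ℝ) : ℂ) - I * δ) * (x : ℂ))) *
          conj ((∫ x : ℝ, g₀ x * cexp (I * (((0 : ℝ) : ℂ) + I * δ) * (x : ℂ))))).re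
      else ‖(∫ x : ℝ, g₀ x * cexp (I * ((((0 : ℝ) + j * s : ℝ) : ℂ)) * (x : ℂ)))‖ ^ 2)
      ((2 * π / s) * (∫ x : ℝ, ‖g₀ x‖ ^ 2)
        - 8 * (∫ y, φ y * Real.exp (δ * y)) ^ 2 * Real.sinh (δ * c₀) ^ 2) := by
  set m : ℝ := ∫ y, φ y * Real.exp (δ * y) with hm
  have hmain := soloBlind_deepPair_hasSum c s 0 δ hs hg hsupp
  -- the three point evaluations
  have hFT : ∀ ε : ℝ, ∀ z : ℂ, (∀ x : ℝ, I * z * x = ((ε * x : ℝ) : ℂ)) →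
      (∫ x : ℝ, g₀ x * cexp (I * (z) * (x : ℂ))) =
        ((2 * Real.sinh (ε * c₀) * ∫ y, φ y * Real.exp (ε * y) : ℝ) : ℂ) := by
    intro ε z hz
    rw [← soloBlind_twoBump_exp_integral hφ hφsupp c₀ ε, ← integral_complex_ofReal]
    congr 1
    funext x
    rw [hz x, ← Complex.ofReal_exp, hg₀]
    push_cast
    ring
  have hminus : (∫ x : ℝ, g₀ x * cexp (I * (((0 : ℝ) : ℂ) - I * δ) * (x : ℂ))) =
      ((2 * Real.sinh (δ * c₀) * m : ℝ) : ℂ) := by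
    apply hFT δ
    intro x
    push_cast
    ring_nf
    rw [I_sq]
    ring
  have hplus : (∫ x : ℝ, g₀ x * cexp (I * (((0 : ℝ) : ℂ) + I * δ) * (x : ℂ))) =
      ((-(2 * Real.sinh (δ * c₀) * m) : ℝ) : ℂ) := by
    have h := hFT (-δ) (((0 : ℝ) : ℂ) + I * δ) (by
      intro x
      push_cast
      ring_nf
      rw [I_sq]
      ring)
    rw [h, soloBlind_even_exp_integral heven δ, ← hm, neg_mul, Real.sinh_neg]
    push_cast
    ring
  have hzero : (∫ x : ℝ, g₀ x * cexp (I * (((0 : ℝ) : ℂ)) * (x : ℂ))) = 0 := by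
    have h := hFT 0 (((0 : ℝ) : ℂ)) (by intro x; push_cast; ring)
    rw [h, zero_mul, Real.sinh_zero]
    push_cast
    ring
  have hP : 2 * ((∫ x : ℝ, g₀ x * cexp (I * (((0 : ℝ) : ℂ) - I * δ) * (x : ℂ))) *
      conj ((∫ x : ℝ, g₀ x * cexp (I * (((0 : ℝ) : ℂ) + I * δ) * (x : ℂ))))).re
      = -(8 * m ^ 2 * Real.sinh (δ * c₀) ^ 2) := by
    rw [hminus, hplus, Complex.conj_ofReal, ← Complex.ofReal_mul, Complex.ofReal_re]
    ring
  have hval : (2 * π / s) * (∫ x : ℝ, ‖g₀ x‖ ^ 2)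
        - ‖(∫ x : ℝ, g₀ x * cexp (I * (((0 : ℝ) : ℂ)) * (x : ℂ)))‖ ^ 2
        + 2 * ((∫ x : ℝ, g₀ x * cexp (I * (((0 : ℝ) : ℂ) - I * δ) * (x : ℂ))) *
            conj ((∫ x : ℝ, g₀ x * cexp (I * (((0 : ℝ) : ℂ) + I * δ) * (x : ℂ))))).re
      = (2 * π / s) * (∫ x : ℝ, ‖g₀ x‖ ^ 2) - 8 * m ^ 2 * Real.sinh (δ * c₀) ^ 2 := by
    rw [hP, hzero, norm_zero]
    ring
  rw [hval] at hmain
  exact hmain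

/-- **Visibility of one deep pair (report §10.3).**  Under the hypotheses of
`soloBlind_deepPair_twoBump` and `φ ≥ 0`: `m = ∫ φ e^{δy} ≥ ∫ φ`, hence the functional of `Z₁(δ)` at the
two-bump function is `≤ (2π/s)‖g₀‖₂² - 8 (∫φ)² sinh²(δ c₀)`; in particular it is NEGATIVE — the pair is
detected at window `g₀`'s support — as soon as `8 (∫φ)² sinh²(δ c₀) > (2π/s) ‖g₀‖₂²`. -/
theorem soloBlind_deepPair_visible (c s δ c₀ b : ℝ) (hs : 0 < s) {φ : ℝ → ℝ}
    (hφ : Integrable φ) (hφsupp : Function.support φ ⊆ Icc (-b) b) (heven : ∀ y, φ (-y) = φ y)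
    (hpos : ∀ y, 0 ≤ φ y)
    {g₀ : ℝ → ℂ} (hg₀ : g₀ = fun x : ℝ => ((φ (x - c₀) - φ (x + c₀) : ℝ) : ℂ))
    (hg : MemLp g₀ 2 volume) (hsupp : Function.support g₀ ⊆ Ioc c (c + 2 * π / s))
    (hbeat : (2 * π / s) * (∫ x : ℝ, ‖g₀ x‖ ^ 2)
      < 8 * (∫ y, φ y) ^ 2 * Real.sinh (δ * c₀) ^ 2) :
    ∃ v : ℝ, v < 0 ∧ HasSum (fun j : ℤ => if j = 0 then
        2 * ((∫ x : ℝ, g₀ x * cexp (I * (((0 : ℝ) : ℂ) - I * δ) * (x : ℂ))) *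
          conj ((∫ x : ℝ, g₀ x * cexp (I * (((0 : ℝ) : ℂ) + I * δ) * (x : ℂ))))).re
      else ‖(∫ x : ℝ, g₀ x * cexp (I * ((((0 : ℝ) + j * s : ℝ) : ℂ)) * (x : ℂ)))‖ ^ 2) v := by
  refine ⟨_, ?_, soloBlind_deepPair_twoBump c s δ c₀ b hs hφ hφsupp heven hg₀ hg hsupp⟩
  -- m ≥ ∫ φ ≥ 0
  have hIp := soloBlind_integrable_mul_exp hφ hφsupp δ
  have hIm := soloBlind_integrable_mul_exp hφ hφsupp (-δ)
  have hm_eq : ∫ y, φ y * Real.exp (δ * y) =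
      ∫ y, φ y * ((Real.exp (δ * y) + Real.exp (-δ * y)) / 2) := by
    have h2 : ∫ y, φ y * ((Real.exp (δ * y) + Real.exp (-δ * y)) / 2) =
        (1 / 2) * ((∫ y, φ y * Real.exp (δ * y)) + ∫ y, φ y * Real.exp (-δ * y)) := by
      rw [← integral_add hIp hIm, ← integral_const_mul]
      congr 1
      funext y
      ring
    rw [h2, soloBlind_even_exp_integral heven δ]
    ring
  have hm_ge : ∫ y, φ y ≤ ∫ y, φ y * Real.exp (δ * y) := by
    rw [hm_eq]
    apply integral_mono hφ
    · have : (fun y => φ y * ((Real.exp (δ * y) + Real.exp (-δ * y)) / 2)) =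
          fun y => (1 / 2) * (φ y * Real.exp (δ * y)) + (1 / 2) * (φ y * Real.exp (-δ * y)) := by
        funext y; ring
      rw [this]
      exact (hIp.const_mul _).add (hIm.const_mul _)
    · intro y
      have hc : 1 ≤ (Real.exp (δ * y) + Real.exp (-δ * y)) / 2 := by
        rw [neg_mul, ← Real.cosh_eq]
        exact Real.one_le_cosh _
      simpa using mul_le_mul_of_nonneg_left hc (hpos y)
  have hφint_nonneg : 0 ≤ ∫ y, φ y := integral_nonneg hpos
  have hsq : (∫ y, φ y) ^ 2 ≤ (∫ y, φ y * Real.exp (δ * y)) ^ 2 :=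
    pow_le_pow_left₀ hφint_nonneg hm_ge 2
  have h8 : 8 * (∫ y, φ y) ^ 2 * Real.sinh (δ * c₀) ^ 2 ≤
      8 * (∫ y, φ y * Real.exp (δ * y)) ^ 2 * Real.sinh (δ * c₀) ^ 2 := by
    apply mul_le_mul_of_nonneg_right _ (sq_nonneg _)
    linarith
  linarith

end Summit.RiemannHypothesis.RiemannHypothesis.Theorems
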